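import Summits.QuantumFields.BalabanUV.T4Continuum.Support.MinimalActionLimit
import Summits.QuantumFields.BalabanUV.T4Continuum.Support.MinimalActionWitness

/-!
# T⁴ programme, spine node NE3 (U1b), reading (A) — LEAF INDEX of the formalisation swarm (typer's statement stub)

Typer unit `b2b-balaban-t4-ne3-formalise-typer` of the NE3 formalisation swarm `t4-ne3-formalise-*` (cell `pub-balaban`),
cut from the acknowledged owner skeleton `t4/b2b-balaban-t4-ne3-p1/SKELETON-NE3-P1.md` v1.1 (owner lineage t4-ne3-p1;
trigger `t4/T4-NE3-TRIGGER.json`, t4-ref2 pass 61 + scope update 62) and recorded in `t4/formal/NE3/DAG.md` (node T) and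
`t4/formal/NE3/LEAVES.md` (row T).

THIS FILE PROVES NOTHING NEW AND ASSERTS NOTHING.  It gives ONE NAME each to the statement shapes the swarm's rows feed —
the typed ROOT-A target (the conclusion of the landed END `MinimalActionRate.actionRate_of_sandwichData`, LITERALLY) and the
leaf bundles that are its hypotheses (the fields of `MinimalActionRate.SandwichData` ∕ `MinimalActionLimit.UpperData` on a
domain of data, and the three [dict] leaves A-H1 ∕ A-H3 ∕ A-H2 on B11's small-field class `sfClass`) — plus by-name
bookkeeping: every theorem below is `Iff.rfl`, a constructor shuffle, or a one-line application of a LANDED theorem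
(`actionRate_of_sandwichData`, `sandwichData_sfClass`, `actionRate_sfClass`, `exists_tendsto_minAct`,
`exists_tendsto_minAct_tail`, `sandwichData_flatCfg`, `actionRate_flatClass`).  Everything is a parametric
DEFINITION of a proposition (`[shape]`) or such a one-liner (`[bookkeeping]`); no `def … : Prop` FACT is minted, no
printed statement is used as a hypothesis, `IsMinimiser` ∕ `Regular` ∕ `SandwichData` ∕ `UpperData` ∕ `sfClass` ∕
`minActReadings` are IMPORTED BY NAME and never restated (trigger c4).

* `RootA d 𝒞 L N b g dom loc` [shape] — `T4EtaRateMin.ActionRate (minActReadings d 𝒞 L N dom loc)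
  (wallConstNA d L·(g + b³)/L²) ((L²)⁻¹)`: the ACTION half of `T4EtaRateMin.NE3Shape` for the minimal-action readings with
  the wall's explicit constant and rate `θ = L⁻²`.  `rootA_iff` unfolds it to the sentence
  `∀ k, ∀ V ∈ dom, |A_{k+1}(V) − A_k(V)| ≤ C·θ^k·N^d` by `Iff.rfl`.
* `LeavesA d 𝒞 L N b g dom` [shape] — `∀ V ∈ dom, SandwichData d 𝒞 L N b g V` (leaves A-H1 ∧ A-H3 ∧ A-H4 ∧ A-H2 of the DAG on
  the domain); `rootA_of_leavesA` IS `actionRate_of_sandwichData` BY NAME.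
* `UpperLeavesA` [shape] — the same without A-H2 (`UpperData`); `exists_limit_of_upperLeavesA` IS `exists_tendsto_minAct`.
* `LeafH1` ∕ `LeafH3` ∕ `LeafH2` [shape] — the three [dict] leaves on `sfClass d L N ε` (A-H4 is a THEOREM there,
  `rescale_bavg_mem_sfClass`): exactly the binders `h1` ∕ `h3` ∕ `h2` of `actionRate_sfClass`; `rootA_sfClass_of_leaves` IS
  that theorem BY NAME.  Row S3 of the swarm discharges `LeafH1` ∕ `LeafH3` from `B11Thm1.Thm1At` on a concrete
  `B11.VarProblem`; the rows R1 (S4b-i, S4b, S4c, S4d, S4e) and the owner's R2 ∕ R0 discharge `LeafH2` through the re-cut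
  socket `MinimalActionRefine.SmoothRefine` (p209344, not imported here until it is in the tree — v2 of this index).
* Non-vacuity (`leavesA_flat`, `rootA_flat`) is `MinimalActionWitness` BY NAME; the rate is honest by
  `MinimalActionRate.rate_lt_one` (not restated here); `ne3Shape_minAct_iff` records that `NE3Shape` on this carrier is the root-A target PLUS the LOCAL half
  `LocalRate` of the caller-supplied reading `loc` — a separate obligation (readings (D)∕(F), the co-owners' energy-distance
  layer), inhabited by nothing here.

HONEST FRAMING: finite torus, minimal actions only; constants OURS (the wall's explicit tree definitions, none a printed
number); reading (A) is COMPLETE AS A COMPOSITION and its leaves are B11 Thm 1 TYPE, asserted for NO Bałaban datum; every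
END headline reads «NE3-(A) CONDITIONAL on ⟨named structures⟩», never «NE3 proved»; NE3 NOT proved; NOT infinite volume ∕
mass gap ∕ `BetaPertH` ∕ Clay; spine PROVED 0/9 unchanged.
HONEST DEPENDENCY: continuum YM on T⁴ ⇐ BetaPertH ∧ nine spine estimates (0/9 proved); BetaPertH ⇐ (D1) ∧ (D4) ∧ CAP+tail;
G-an2-4 gates asym, D1 and NE2/3/4.

References (shapes only, nothing printed is a hypothesis): [Balaban1985Variational] = B11, CMP 102 (1985) 277–309, Thm 1
(8)–(10) pp. 278–279, spaces (2), (6), (7) p. 278; [Balaban1985AveragingOperations] = B7, Prop. 1 (51) p. 26.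
-/

noncomputable section

open scoped BigOperators Matrix Matrix.Norms.L2Operator Topology
open NormedSpace Finset Filter

namespace Summit.QuantumFields.BalabanUV.T4Continuum.NE3.LeafIndex

open Literature.MathematicalPhysics.QuantumFieldTheory.Balaban1983to89
open B7Prop1Explicit B7Prop2Explicit MatrixLog UnitaryModel
open T4AveragingDeficitWall hiding Site Plane Plaq Bond
open T4AveragingDeficitWallBoundary (IsPeriodicCfg periodBox)
open T4AveragingDeficitNonAbelian (wallConstNA wallConstNA_nonneg)
open T4EtaRateMin (Readings ActionRate LocalRate NE3Shape)
open Summit.QuantumFields.BalabanUV.T4Continuum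
open MinimalActionLevels MinimalActionSandwich MinimalActionRate MinimalActionLimit MinimalActionWitness

variable {d : ℕ} {n : Type*} [Fintype n] [DecidableEq n]

/-! ## §1 The typed ROOT-A target -/

variable (d) in
/-- **ROOT-A** [shape]: the ACTION half of NE3 for the minimal-action readings `minActReadings d 𝒞 L N dom loc` with the
wall's constant `wallConstNA(d,L)·(g + b³)/L²` and rate `L⁻²` — LITERALLY the conclusion of
`MinimalActionRate.actionRate_of_sandwichData` (p204845).  A name, not a claim. [folklore] -/
def RootA (𝒞 : ℕ → Set (B7Prop1Explicit.Site d → Fin d → (Matrix n n ℂ)ˣ)) (L N : ℕ) (b g : ℝ)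
    (dom : Set (B7Prop1Explicit.Site d → Fin d → (Matrix n n ℂ)ˣ)) {X : Type*}
    (loc : ℕ → (B7Prop1Explicit.Site d → Fin d → (Matrix n n ℂ)ˣ) → X → ℝ) : Prop :=
  ActionRate (minActReadings d 𝒞 L N dom loc) (wallConstNA d L * (g + b ^ 3) / (L : ℝ) ^ 2) (((L : ℝ) ^ 2)⁻¹)

/-- [bookkeeping] ROOT-A unfolded: `∀ k, ∀ V ∈ dom, |A_{k+1}(V) − A_k(V)| ≤ C·(L⁻²)^k·N^d` with
`A_k(V) = minAct d 𝒞 L N k V` — definitionally (`Iff.rfl`). [folklore] -/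
theorem rootA_iff (𝒞 : ℕ → Set (B7Prop1Explicit.Site d → Fin d → (Matrix n n ℂ)ˣ)) (L N : ℕ) (b g : ℝ)
    (dom : Set (B7Prop1Explicit.Site d → Fin d → (Matrix n n ℂ)ˣ)) {X : Type*}
    (loc : ℕ → (B7Prop1Explicit.Site d → Fin d → (Matrix n n ℂ)ˣ) → X → ℝ) :
    RootA d 𝒞 L N b g dom loc ↔
      ∀ k : ℕ, ∀ V ∈ dom, |minAct d 𝒞 L N (k + 1) V - minAct d 𝒞 L N k V|
        ≤ wallConstNA d L * (g + b ^ 3) / (L : ℝ) ^ 2 * (((L : ℝ) ^ 2)⁻¹) ^ k * (N : ℝ) ^ d :=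
  Iff.rfl

/-- [bookkeeping] `NE3Shape` on the minimal-action carrier = the two rate facts + ROOT-A + the LOCAL half `LocalRate` of
the caller-supplied reading `loc` (readings (D)∕(F): a SEPARATE obligation, inhabited by nothing in this file).
[folklore] -/
theorem ne3Shape_minAct_iff (𝒞 : ℕ → Set (B7Prop1Explicit.Site d → Fin d → (Matrix n n ℂ)ˣ)) (L N : ℕ) (b g : ℝ)
    (dom : Set (B7Prop1Explicit.Site d → Fin d → (Matrix n n ℂ)ˣ)) {X : Type*}
    (loc : ℕ → (B7Prop1Explicit.Site d → Fin d → (Matrix n n ℂ)ˣ) → X → ℝ) :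
    NE3Shape (minActReadings d 𝒞 L N dom loc) (wallConstNA d L * (g + b ^ 3) / (L : ℝ) ^ 2) (((L : ℝ) ^ 2)⁻¹) ↔
      (0 ≤ ((L : ℝ) ^ 2)⁻¹ ∧ ((L : ℝ) ^ 2)⁻¹ < 1) ∧ RootA d 𝒞 L N b g dom loc ∧
        LocalRate (minActReadings d 𝒞 L N dom loc) (wallConstNA d L * (g + b ^ 3) / (L : ℝ) ^ 2) (((L : ℝ) ^ 2)⁻¹) :=
  ⟨fun h => ⟨⟨h.rate_nonneg, h.rate_lt_one⟩, h.action, h.pointwise⟩,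
    fun h => ⟨h.1.1, h.1.2, h.2.1, h.2.2⟩⟩

/-! ## §2 The leaf bundles of END-A (shapes) and the END faces BY NAME -/

variable (d) in
/-- **LEAVES-A** [shape]: every datum of `dom` carries `SandwichData` — leaves A-H1 (`exists_minimiser`), A-H3
(`regular`), A-H4 (`avg_mem`), A-H2 (`refine`) of the DAG, i.e. LITERALLY the hypothesis `hdom` of
`actionRate_of_sandwichData`.  Asserted for no domain here. [folklore] -/
def LeavesA (𝒞 : ℕ → Set (B7Prop1Explicit.Site d → Fin d → (Matrix n n ℂ)ˣ)) (L N : ℕ) (b g : ℝ)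
    (dom : Set (B7Prop1Explicit.Site d → Fin d → (Matrix n n ℂ)ˣ)) : Prop :=
  ∀ V ∈ dom, SandwichData d 𝒞 L N b g V

variable (d) in
/-- **UPPER-LEAVES-A** [shape]: every datum of `dom` carries `UpperData` (A-H1 ∧ A-H3 ∧ A-H4, no refinement leaf) — what
EXISTENCE of `lim_k A_k(V)` needs (`exists_tendsto_minAct`). [folklore] -/
def UpperLeavesA (𝒞 : ℕ → Set (B7Prop1Explicit.Site d → Fin d → (Matrix n n ℂ)ˣ)) (L N : ℕ) (b g : ℝ)
    (dom : Set (B7Prop1Explicit.Site d → Fin d → (Matrix n n ℂ)ˣ)) : Prop :=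
  ∀ V ∈ dom, UpperData d 𝒞 L N b g V

/-- [bookkeeping] LEAVES-A ⟹ UPPER-LEAVES-A (drop the refinement leaf; `SandwichData.toUpperData`). [folklore] -/
theorem upperLeavesA_of_leavesA {𝒞 : ℕ → Set (B7Prop1Explicit.Site d → Fin d → (Matrix n n ℂ)ˣ)} {L N : ℕ}
    {b g : ℝ} {dom : Set (B7Prop1Explicit.Site d → Fin d → (Matrix n n ℂ)ˣ)} (h : LeavesA d 𝒞 L N b g dom) :
    UpperLeavesA d 𝒞 L N b g dom :=
  fun V hV => (h V hV).toUpperData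

/-- **END-A BY NAME** [bookkeeping]: LEAVES-A ⟹ ROOT-A for every supplied local reading — this IS
`MinimalActionRate.actionRate_of_sandwichData` (p204845), restated on the named shapes; binders `1 ≤ L`, `1 ≤ N`, `0 ≤ b`,
`512(d+1)(d+4)L²b ≤ 1` verbatim. [folklore] -/
theorem rootA_of_leavesA [Nonempty n] {𝒞 : ℕ → Set (B7Prop1Explicit.Site d → Fin d → (Matrix n n ℂ)ˣ)} {L N : ℕ}
    (hL : 1 ≤ L) (hN : 1 ≤ N) {b g : ℝ} (hb : 0 ≤ b) (hbs : 512 * (d + 1) * (d + 4) * (L : ℝ) ^ 2 * b ≤ 1)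
    {dom : Set (B7Prop1Explicit.Site d → Fin d → (Matrix n n ℂ)ˣ)} (h : LeavesA d 𝒞 L N b g dom) {X : Type*}
    (loc : ℕ → (B7Prop1Explicit.Site d → Fin d → (Matrix n n ℂ)ˣ) → X → ℝ) : RootA d 𝒞 L N b g dom loc :=
  actionRate_of_sandwichData hL hN hb hbs h loc

/-- **END-A′ BY NAME** [bookkeeping]: UPPER-LEAVES-A ⟹ the minimal actions of every datum CONVERGE
(`MinimalActionLimit.exists_tendsto_minAct`, p204971; `2 ≤ L`, `0 ≤ g`). [folklore] -/
theorem exists_limit_of_upperLeavesA [Nonempty n] {𝒞 : ℕ → Set (B7Prop1Explicit.Site d → Fin d → (Matrix n n ℂ)ˣ)}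
    {L N : ℕ} (hL : 2 ≤ L) (hN : 1 ≤ N) {b g : ℝ} (hb : 0 ≤ b)
    (hbs : 512 * (d + 1) * (d + 4) * (L : ℝ) ^ 2 * b ≤ 1) (hg : 0 ≤ g)
    {dom : Set (B7Prop1Explicit.Site d → Fin d → (Matrix n n ℂ)ˣ)} (h : UpperLeavesA d 𝒞 L N b g dom) :
    ∀ V ∈ dom, ∃ A : ℝ, Tendsto (fun k => minAct d 𝒞 L N k V) atTop (𝓝 A) :=
  fun V hV => exists_tendsto_minAct hL hN hb hbs hg (h V hV)

/-- [bookkeeping] LEAVES-A ⟹ limit WITH geometric tail (`MinimalActionLimit.exists_tendsto_minAct_tail`, p205224).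
[folklore] -/
theorem exists_limit_tail_of_leavesA [Nonempty n] {𝒞 : ℕ → Set (B7Prop1Explicit.Site d → Fin d → (Matrix n n ℂ)ˣ)}
    {L N : ℕ} (hL : 2 ≤ L) (hN : 1 ≤ N) {b g : ℝ} (hb : 0 ≤ b)
    (hbs : 512 * (d + 1) * (d + 4) * (L : ℝ) ^ 2 * b ≤ 1)
    {dom : Set (B7Prop1Explicit.Site d → Fin d → (Matrix n n ℂ)ˣ)} (h : LeavesA d 𝒞 L N b g dom) :
    ∀ V ∈ dom, ∃ A : ℝ, Tendsto (fun k => minAct d 𝒞 L N k V) atTop (𝓝 A) ∧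
      ∀ k : ℕ, |minAct d 𝒞 L N k V - A|
        ≤ wallConstNA d L * (g + b ^ 3) / (L : ℝ) ^ 2 * (N : ℝ) ^ d * (((L : ℝ) ^ 2)⁻¹) ^ k
            / (1 - ((L : ℝ) ^ 2)⁻¹) :=
  fun V hV => exists_tendsto_minAct_tail hL hN hb hbs (h V hV)

/-! ## §3 The three [dict] leaves on B11's small-field class `sfClass` (rows S3 and R0∕R1∕R2 of the swarm) -/

variable (d) in
/-- **LEAF A-H1 on `sfClass`** [shape]: every run of every datum of `dom` has a minimiser in the small-field class
(dictionary: B11 Thm 1 (8), existence of a minimal orbit — a TYPE, asserted for nothing; row S3 discharges it from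
`B11Thm1.Thm1At` on a concrete `VarProblem`).  LITERALLY binder `h1` of `actionRate_sfClass`. [folklore] -/
def LeafH1 (L N : ℕ) (ε : ℝ) (dom : Set (B7Prop1Explicit.Site d → Fin d → (Matrix n n ℂ)ˣ)) : Prop :=
  ∀ V ∈ dom, ∀ k : ℕ, ∃ U, IsMinimiser d (sfClass d L N ε) L N k V U

variable (d) in
/-- **LEAF A-H3 on `sfClass`** [shape]: every minimiser of run `k+1` is `Regular … b g (k+1)` (dictionary: B11 Thm 1
(8)–(10) TYPE + the folklore steps S1 (interior H², SUPPLIED `AveragingDeficitLatticeH2.latticeH2`) and S2 (gauge∕BCH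
dictionary, row NE3-R2)).  LITERALLY binder `h3` of `actionRate_sfClass`. [folklore] -/
def LeafH3 (L N : ℕ) (ε b g : ℝ) (dom : Set (B7Prop1Explicit.Site d → Fin d → (Matrix n n ℂ)ˣ)) : Prop :=
  ∀ V ∈ dom, ∀ (k : ℕ) (U : B7Prop1Explicit.Site d → Fin d → (Matrix n n ℂ)ˣ),
    IsMinimiser d (sfClass d L N ε) L N (k + 1) V U → Regular d L N b g (k + 1) U

variable (d) in
/-- **LEAF A-H2 on `sfClass`** [shape]: every minimiser of run `k` is the rescaled one-step average of a `Regular … (k+1)`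
configuration of the class (OURS — the kinematic lemma R1 ∧ R2 through the owner's socket
`MinimalActionRefine.SmoothRefine`, p209344; in print nowhere).  LITERALLY binder `h2` of `actionRate_sfClass`.
[folklore] -/
def LeafH2 (L N : ℕ) (ε b g : ℝ) (dom : Set (B7Prop1Explicit.Site d → Fin d → (Matrix n n ℂ)ˣ)) : Prop :=
  ∀ V ∈ dom, ∀ (k : ℕ) (U : B7Prop1Explicit.Site d → Fin d → (Matrix n n ℂ)ˣ),
    IsMinimiser d (sfClass d L N ε) L N k V U →
      ∃ Ut, Ut ∈ sfClass d L N ε (k + 1) ∧ rescale L (bavg L Ut) = U ∧ Regular d L N b g (k + 1) Ut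

/-- [bookkeeping] on `sfClass`, the three [dict] leaves give LEAVES-A — A-H4 is the THEOREM `rescale_bavg_mem_sfClass`
(B7 Prop. 1) inside `MinimalActionRate.sandwichData_sfClass`; extra binder `b + 226(8(d+1)(d+4))²b² ≤ ε` = the
class-transport radius. [folklore] -/
theorem leavesA_sfClass_of_leaves [Nonempty n] {L N : ℕ} (hL : 1 ≤ L) {b g ε : ℝ} (hb : 0 ≤ b)
    (hbs : 512 * (d + 1) * (d + 4) * (L : ℝ) ^ 2 * b ≤ 1) (hbε : b + 226 * (8 * (d + 1) * (d + 4)) ^ 2 * b ^ 2 ≤ ε)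
    {dom : Set (B7Prop1Explicit.Site d → Fin d → (Matrix n n ℂ)ˣ)} (h1 : LeafH1 d L N ε dom)
    (h3 : LeafH3 d L N ε b g dom) (h2 : LeafH2 d L N ε b g dom) : LeavesA d (sfClass d L N ε) L N b g dom :=
  fun V hV => sandwichData_sfClass hL hb hbs hbε (h1 V hV) (h3 V hV) (h2 V hV)

/-- **END-A ON THE SMALL-FIELD CLASS BY NAME** [bookkeeping]: the three [dict] leaves ⟹ ROOT-A on `sfClass d L N ε` —
this IS `MinimalActionRate.actionRate_sfClass` (p204845). [folklore] -/
theorem rootA_sfClass_of_leaves [Nonempty n] {L N : ℕ} (hL : 1 ≤ L) (hN : 1 ≤ N) {b g ε : ℝ} (hb : 0 ≤ b)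
    (hbs : 512 * (d + 1) * (d + 4) * (L : ℝ) ^ 2 * b ≤ 1) (hbε : b + 226 * (8 * (d + 1) * (d + 4)) ^ 2 * b ^ 2 ≤ ε)
    {dom : Set (B7Prop1Explicit.Site d → Fin d → (Matrix n n ℂ)ˣ)} (h1 : LeafH1 d L N ε dom)
    (h3 : LeafH3 d L N ε b g dom) (h2 : LeafH2 d L N ε b g dom) {X : Type*}
    (loc : ℕ → (B7Prop1Explicit.Site d → Fin d → (Matrix n n ℂ)ˣ) → X → ℝ) :
    RootA d (sfClass d L N ε) L N b g dom loc :=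
  actionRate_sfClass hL hN hb hbs hbε h1 h3 h2 loc

/-! ## §4 Non-vacuity BY NAME (`MinimalActionWitness`, p204967) -/

/-- [bookkeeping] the shapes are jointly inhabited: LEAVES-A holds for the flat class family at the flat datum
(`sandwichData_flatCfg`). [folklore] -/
theorem leavesA_flat (L N : ℕ) {b g : ℝ} (hb : 0 ≤ b) (hg : 0 ≤ g) :
    LeavesA d (flatClass : ℕ → Set (B7Prop1Explicit.Site d → Fin d → (Matrix n n ℂ)ˣ)) L N b g {flatCfg} :=
  fun V hV => by
    rw [Set.mem_singleton_iff.mp hV]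
    exact sandwichData_flatCfg L N hb hg

/-- [bookkeeping] … hence ROOT-A is inhabited (honestly, if trivially) for every supplied local reading
(`actionRate_flatClass`). [folklore] -/
theorem rootA_flat [Nonempty n] {L N : ℕ} (hL : 1 ≤ L) (hN : 1 ≤ N) {b g : ℝ} (hb : 0 ≤ b)
    (hbs : 512 * (d + 1) * (d + 4) * (L : ℝ) ^ 2 * b ≤ 1) (hg : 0 ≤ g) {X : Type*}
    (loc : ℕ → (B7Prop1Explicit.Site d → Fin d → (Matrix n n ℂ)ˣ) → X → ℝ) :
    RootA d (flatClass : ℕ → Set (B7Prop1Explicit.Site d → Fin d → (Matrix n n ℂ)ˣ)) L N b g {flatCfg} loc :=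
  actionRate_flatClass hL hN hb hbs hg loc

end Summit.QuantumFields.BalabanUV.T4Continuum.NE3.LeafIndex

end
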